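import Summits.CriticalPhenomena.CardyFormulaZ2.Theorems.CardyMagicRigidityMarkovCascadeDefs
import Literature.Probability.Percolation.SiteLoopDensity
import HarnessLib

/-!
# Microscopic loops of both types of the closed-b.c. `δ𝕋` ball ensemble are dense away from the boundary

Helper toward crux `NestingRigidity` (stmt-CriticalPhenomena-4835), line `markov-cascade-one-generation`:
the closed-boundary-condition twin of `tendsto_measure_setOf_sparse_siteLoopConfig` (`SiteLoopDensity.lean`,
the template) for the domain ensemble `domLoopsT (ball 0 R) δ ω = siteLoopConfig δ (ω ∩ triMeshVertices (ball 0 R) δ)`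
(every site drawn outside `ball 0 R` declared closed). The only new point w.r.t. the template is that an
isolated site `x` of colour `i` of `ω` (`isoEvent i x`) stays isolated of colour `i` in the restricted
configuration `ω ∩ V` as soon as its seven-site star `hexStar x` lies in `V`
(`inter_mem_isoEvent_of_hexStar_subset`), and that the stars of the row sites used by the template near a
point of `closedBall 0 R₀` are drawn inside `ball 0 (R₀ + η) ⊆ ball 0 R` at *every* mesh
(`hexStar_subset_triMeshVertices`): the hexagon loop of type `i` around such a site is then a member of
the domain ensemble (`exists_mem_siteLoopConfig_of_isoEvent` applied to `ω ∩ V`). Everything else —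
positivity `c₀` of the isolated-site events, disjoint-star independence along the rows `a + 3j e₀`, the
union bound over an `η/2`-net — is the template verbatim.
-/

noncomputable section

open MeasureTheory Set Filter
open scoped Topology BigOperators ENNReal Real

namespace Summit.CriticalPhenomena.CardyFormulaZ2.Cruxes.NestingRigidity.MarkovCascadeOneGeneration

open Literature.Probability.RandomPlanarGeometry Literature.Probability.Percolation
  Literature.Probability.LatticeModels
open Summit.CriticalPhenomena.CardyFormulaZ2.Theses.CardyMagicRigidity

/-! ### Isolated sites survive the closed boundary condition when their star is inside -/

/-- **Isolation is local to the star.** If the seven-site star of `x` lies in `V`, then an isolated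
site of colour `i` at `x` of `ω` is an isolated site of colour `i` at `x` of the restricted configuration
`ω ∩ V` (closing sites outside `V` changes nothing on the star). [folklore] -/
theorem inter_mem_isoEvent_of_hexStar_subset {ω : SiteConfig (Site 2)} {V : Set (Site 2)} {x : Site 2}
    {i : Fin 2} (hV : (↑(hexStar x) : Set (Site 2)) ⊆ V) (h : ω ∈ isoEvent i x) : ω ∩ V ∈ isoEvent i x := by
  revert h
  fin_cases i
  · simp only [Fin.zero_eta, isoEvent_zero, isoClosed, mem_setOf_eq, mem_inter_iff, not_and]
    exact fun h ↦ ⟨fun hx _ ↦ h.1 hx, fun k ↦ ⟨h.2 k, hV (add_hexDir_mem_hexStar x k)⟩⟩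
  · simp only [Fin.mk_one, isoEvent_one, isoOpen, mem_setOf_eq, mem_inter_iff, not_and]
    exact fun h ↦ ⟨⟨h.1, hV (self_mem_hexStar x)⟩, fun k hk _ ↦ h.2 k hk⟩

/-- The sites of the star of `x`, drawn at mesh `δ ≥ 0`, lie in the closed `δ`-ball about the mesh
point of `x` (the six outer sites are the neighbours of `x`, at distance `δ`). [folklore] -/
theorem triMeshPoint_mem_closedBall_of_mem_hexStar {δ : ℝ} (hδ : 0 ≤ δ) {x v : Site 2} (hv : v ∈ hexStar x) :
    triMeshPoint δ v ∈ Metric.closedBall (triMeshPoint δ x) δ := by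
  rw [hexStar, Finset.mem_insert, Finset.mem_image] at hv
  rw [Metric.mem_closedBall]
  rcases hv with rfl | ⟨k, -, rfl⟩
  · rw [dist_self]; exact hδ
  · rw [dist_comm, dist_eq_norm, triMeshPoint, triMeshPoint, ← mul_sub, norm_mul, Complex.norm_real,
      Real.norm_of_nonneg hδ, norm_triEmbed_eq_one_of_adj (triGraph_adj_add_hexDir x k), mul_one]

/-- **The stars of the row sites are drawn inside the domain.** If the closed `δ`-ball about the
mesh point of `x` lies in `ball z' (η/2)` with `‖z'‖ ≤ R₀` and `R₀ + η < R`, then every site of the star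
of `x` is a vertex of `δ𝕋 ∩ ball 0 R` (`triMeshVertices`). [folklore] -/
theorem hexStar_subset_triMeshVertices {δ : ℝ} (hδ : 0 ≤ δ) {x : Site 2} {z' : ℂ} {R R₀ η : ℝ}
    (hz' : z' ∈ Metric.closedBall (0 : ℂ) R₀) (hR : R₀ + η < R)
    (hx : Metric.closedBall (triMeshPoint δ x) δ ⊆ Metric.ball z' (η / 2)) :
    (↑(hexStar x) : Set (Site 2)) ⊆ triMeshVertices (Metric.ball 0 R) δ := by
  intro v hv
  have h1 := hx (triMeshPoint_mem_closedBall_of_mem_hexStar hδ (Finset.mem_coe.1 hv))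
  rw [Metric.mem_ball] at h1
  rw [Metric.mem_closedBall, dist_zero_right] at hz'
  show triMeshPoint δ v ∈ Metric.ball (0 : ℂ) R
  rw [Metric.mem_ball, dist_zero_right]
  have hη : 0 ≤ η / 2 := by linarith [dist_nonneg.trans_lt h1]
  calc ‖triMeshPoint δ v‖ = dist (triMeshPoint δ v) 0 := (dist_zero_right _).symm
    _ ≤ dist (triMeshPoint δ v) z' + dist z' 0 := dist_triangle _ _ _
    _ < η / 2 + R₀ := by rw [dist_zero_right]; linarith
    _ < R := by linarith

/-! ### Assembly: microscopic loops of both types are dense with high probability -/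

/-- **Fixed-mesh bound.** Let `c ≤ P_{1/2}(isoEvent i x)` for all `i, x`, and let the finite set
`t ⊆ closedBall 0 R₀` be an `η/2`-net of `closedBall 0 R₀`, `R₀ + η < R`. Then at every mesh `δ > 0` the
event "some point of `closedBall 0 R₀` has no loop of some type of the closed-b.c. ball ensemble
`domLoopsT (ball 0 R) δ ω` inside its `η`-ball" has probability at most `|t| · 2 · (1 - c)^{⌊η/(8δ)⌋}`:
around the lattice point nearest to each `z' ∈ t`, the `⌊η/(8δ)⌋` row sites have disjoint stars inside
`ball z' (η/2) ⊆ ball 0 R`, so an isolated site of colour `i` of `ω` at any of them is still isolated in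
`ω ∩ triMeshVertices (ball 0 R) δ` and puts a hexagon loop of type `i` of the domain ensemble inside
`ball z' (η/2) ⊆ ball z η` for every `z ∈ ball z' (η/2)`. [folklore] -/
theorem measure_setOf_sparse_domLoopsT_le {c : ℝ}
    (hc : ∀ (i : Fin 2) (x : Site 2), c ≤ (triSitePercolation half).real (isoEvent i x)) {R R₀ η : ℝ}
    (hη : 0 < η) (hR : R₀ + η < R) {t : Finset ℂ} (ht : (↑t : Set ℂ) ⊆ Metric.closedBall (0 : ℂ) R₀)
    (hcover : Metric.closedBall (0 : ℂ) R₀ ⊆ ⋃ z' ∈ t, Metric.ball z' (η / 2)) {δ : ℝ} (hδ : 0 < δ) :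
    PT {ω | ∃ z ∈ Metric.closedBall (0 : ℂ) R₀, ∃ i : Fin 2,
        ∀ u ∈ (domLoopsT (Metric.ball 0 R) δ ω).F i, ¬ u.range ⊆ Metric.ball z η} ≤
      (t.card : ℝ≥0∞) * (2 * ENNReal.ofReal ((1 - c) ^ ⌊η / (8 * δ)⌋₊)) := by
  set N := ⌊η / (8 * δ)⌋₊ with hN
  have hNδ : 3 * (N : ℝ) * δ ≤ 3 * η / 8 := by
    have h1 : (N : ℝ) ≤ η / (8 * δ) := Nat.floor_le (by positivity)
    rw [le_div_iff₀ (by positivity)] at h1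
    nlinarith
  choose a ha using fun z' : ℂ ↦ exists_dist_triMeshPoint_le hδ z'
  set Bad : ℂ → Fin 2 → Set (SiteConfig (Site 2)) := fun z' i ↦ ⋂ j < N, (isoEvent i (rowSite (a z') j))ᶜ
    with hBad
  have hsub : {ω : SiteConfig (Site 2) | ∃ z ∈ Metric.closedBall (0 : ℂ) R₀, ∃ i : Fin 2,
      ∀ u ∈ (domLoopsT (Metric.ball 0 R) δ ω).F i, ¬ u.range ⊆ Metric.ball z η} ⊆
        ⋃ z' ∈ t, ⋃ i : Fin 2, Bad z' i := by
    rintro ω ⟨z, hz, i, hzi⟩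
    obtain ⟨z', hz't, hzz'⟩ := mem_iUnion₂.1 (hcover hz)
    refine mem_iUnion₂.2 ⟨z', hz't, mem_iUnion.2 ⟨i, ?_⟩⟩
    by_contra hnot
    simp only [hBad, mem_iInter, mem_compl_iff, not_forall, not_not] at hnot
    obtain ⟨j, hj, hωj⟩ := hnot
    have hrow := Literature.Probability.Percolation.closedBall_rowSite_subset_ball hδ (ha z') hj hNδ
    have hV := hexStar_subset_triMeshVertices hδ.le (ht (Finset.mem_coe.2 hz't)) hR hrow
    obtain ⟨u, hu, hur⟩ :=
      exists_mem_siteLoopConfig_of_isoEvent hδ.le (inter_mem_isoEvent_of_hexStar_subset hV hωj)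
    refine hzi u hu (hur.trans (hrow.trans ?_))
    refine Metric.ball_subset_ball' ?_
    rw [Metric.mem_ball, dist_comm] at hzz'
    linarith
  calc PT {ω | ∃ z ∈ Metric.closedBall (0 : ℂ) R₀, ∃ i : Fin 2,
          ∀ u ∈ (domLoopsT (Metric.ball 0 R) δ ω).F i, ¬ u.range ⊆ Metric.ball z η}
      ≤ PT (⋃ z' ∈ t, ⋃ i : Fin 2, Bad z' i) := measure_mono hsub
    _ ≤ ∑ z' ∈ t, PT (⋃ i : Fin 2, Bad z' i) := measure_biUnion_finset_le t _
    _ ≤ ∑ z' ∈ t, ∑ i : Fin 2, PT (Bad z' i) :=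
        Finset.sum_le_sum fun z' _ ↦ measure_iUnion_fintype_le _ _
    _ ≤ ∑ z' ∈ t, ∑ i : Fin 2, ENNReal.ofReal ((1 - c) ^ N) := by
        refine Finset.sum_le_sum fun z' _ ↦ Finset.sum_le_sum fun i _ ↦ ?_
        rw [← ofReal_measureReal]
        exact ENNReal.ofReal_le_ofReal (real_iInter_compl_isoEvent_rowSite_le hc i (a z') N)
    _ = (t.card : ℝ≥0∞) * (2 * ENNReal.ofReal ((1 - c) ^ N)) := by
        rw [Finset.sum_const, Finset.sum_const, Finset.card_univ, Fintype.card_fin, nsmul_eq_mul,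
          nsmul_eq_mul, Nat.cast_ofNat]

/-- **Microscopic interface loops of both types of the closed-b.c. `δ𝕋` ball ensemble are dense with
high probability away from the boundary** (closed-boundary-condition twin of
`tendsto_measure_setOf_sparse_siteLoopConfig`; Camia–Newman, CMP 268 (2006), Thm 2 (ii), at the lattice
level: isolated open and isolated closed sites are everywhere). For radii `R₀ + η < R`, `η > 0`, the
`P_{1/2}`-probability that some point `z` of `closedBall 0 R₀` has, for some type `i`, **no** member of
type `i` of the domain ensemble `domLoopsT (ball 0 R) δ ω = siteLoopConfig δ (ω ∩ triMeshVertices (ball 0 R) δ)`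
with trace inside `ball z η` tends to `0` as `δ → 0⁺` (quantitatively `measure_setOf_sparse_domLoopsT_le`):
the lattice input matching the small loops of the domain ensembles in DKKMO's relation `d_CN ≤ ε`
(`LoopConfig.IsClose`, no lower cut-off) along the Markov cascade. [folklore] -/
theorem tendsto_measure_setOf_sparse_domLoopsT : ∀ (R R₀ : ℝ) {η : ℝ}, 0 < η → R₀ + η < R → Tendsto (fun δ : ℝ ↦ PT {ω | ∃ z ∈ Metric.closedBall (0 : ℂ) R₀, ∃ i : Fin 2, ∀ u ∈ (domLoopsT (Metric.ball 0 R) δ ω).F i, ¬ u.range ⊆ Metric.ball z η}) (𝓝[>] 0) (𝓝 0) := by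
  intro R R₀ η hη hR
  obtain ⟨c, hc0, hc1, hc⟩ := exists_pos_le_real_isoEvent
  obtain ⟨t₀, ht₀R, ht₀, hcover⟩ :=
    finite_cover_balls_of_compact (isCompact_closedBall (0 : ℂ) R₀) (half_pos hη)
  set t := ht₀.toFinset with ht
  have htR : (↑t : Set ℂ) ⊆ Metric.closedBall (0 : ℂ) R₀ := by
    simpa only [ht, Set.Finite.coe_toFinset] using ht₀R
  have hcover' : Metric.closedBall (0 : ℂ) R₀ ⊆ ⋃ z' ∈ t, Metric.ball z' (η / 2) := by
    simpa only [ht, Set.Finite.mem_toFinset] using hcover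
  have hN : Tendsto (fun δ : ℝ ↦ ⌊η / (8 * δ)⌋₊) (𝓝[>] 0) atTop := by
    refine tendsto_nat_floor_atTop.comp ?_
    refine (tendsto_inv_nhdsGT_zero.const_mul_atTop (show 0 < η / 8 by positivity)).congr fun δ ↦ ?_
    rw [← div_div, div_eq_mul_inv (η / 8) δ]
  have hpow : Tendsto (fun δ : ℝ ↦ (1 - c) ^ ⌊η / (8 * δ)⌋₊) (𝓝[>] 0) (𝓝 0) :=
    (tendsto_pow_atTop_nhds_zero_of_lt_one (by linarith) (by linarith)).comp hN
  have hlim : Tendsto (fun δ : ℝ ↦ (t.card : ℝ≥0∞) * (2 * ENNReal.ofReal ((1 - c) ^ ⌊η / (8 * δ)⌋₊)))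
      (𝓝[>] 0) (𝓝 0) := by
    simpa only [ENNReal.ofReal_zero, mul_zero] using ENNReal.Tendsto.const_mul (a := (t.card : ℝ≥0∞))
      (ENNReal.Tendsto.const_mul (a := 2) (ENNReal.tendsto_ofReal hpow) (Or.inr ENNReal.ofNat_ne_top))
      (Or.inr (ENNReal.natCast_ne_top t.card))
  refine tendsto_of_tendsto_of_tendsto_of_le_of_le' tendsto_const_nhds hlim
    (Eventually.of_forall fun _ ↦ bot_le) ?_
  filter_upwards [self_mem_nhdsWithin] with δ hδ
  exact measure_setOf_sparse_domLoopsT_le hc hη hR htR hcover' hδ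

end Summit.CriticalPhenomena.CardyFormulaZ2.Cruxes.NestingRigidity.MarkovCascadeOneGeneration

end
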